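import Summits.CriticalPhenomena.PercolationContinuityZ3.Theorems.PercNearOneGluingNoHeavyLowerTailSunflowerPrincipalCore
import Literature.Probability.LatticeModels.SahiE3Reflection
import HarnessLib

/-!
# `NoHeavyLowerTail` (crux stmt-CriticalPhenomena-4575), abstract sunflower cubic: the PRINCIPAL-BOTTOM stratum —
# Lemma B `Π_i μ(D_i) ≤ μ(B)^{k−1}` holds UNCONDITIONALLY when the bottom cell `B` is a principal ideal (dual of
# `…SunflowerPrincipalCore` under the reflection `ω ↦ ωᶜ`, `p ↦ 1 − p`)

Support file (seat `prim-ineq-prove-1` gen 34; `--supports stmt-CriticalPhenomena-4575`; companion of `…SunflowerPrincipalCore`).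
Nothing is asserted about the crux; no `sorry`, no named facts, standard axioms.  Memo:
run/shared/lean/prim/prim-ineq-prove-1/FINDING-PRINCIPALCORE-prove1-g34.md.

* `PrincipalCore.prod_real_le_prod_pow_of_isLowerSet` — for DOWN-sets `D i` of a finite cube (`i : κ`, finite) whose pairwise
  intersections lie in the principal ideal `{ω | ω ∩ g = ∅}`: `∏_i μ(D i) ≤ (∏_{e∈g} (1 − p e))^{|κ|−1}` (reflect every `D i` to the up-set
  `compl ⁻¹' (D i)`, whose pairwise intersections lie in the principal FILTER of `g`, and apply `PrincipalCore.prod_real_le_prod_pow`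
  at the reflected parameter `1 − p`, `prodBernoulli_real_preimage_compl`).
* `lemmaB_of_principalBottom` — for ANY three up-sets `E_i` whose union has complement `{ω | ω ∩ g = ∅}`, the down-sets
  `D_i = (E_j ∪ E_k)ᶜ` satisfy `μ(D₁)μ(D₂)μ(D₃) ≤ μ((E₁∪E₂∪E₃)ᶜ)²` (no sunflower condition needed: `D_i ∩ D_j = (⋃ E)ᶜ` always).
* For a three-petal SUNFLOWER (pairwise intersections `A`) with principal bottom: `cells_eq'` (`μ(D_i) = b + c_i`), Lemma B in cells
  `e3_le_bottom_mul_AG` (`c₁c₂c₃ ≤ b(ab − e₂)`), and the payer dichotomy `e3_le_max_mul_AG_of_principalBottom` ((C1-law) on this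
  stratum, unconditionally).  Example: every PRODUCT-type composition `θ∘(g₁,g₂,g₃)` with AND-gadgets has bottom `{ω ∩ (∪ blocks) = ∅}`.
Together with the companion file: on the principal-core stratum Lemma A pays for every `p`, on the principal-bottom stratum Lemma B
pays for every `p`; the density hypothesis `a ≥ b` / `b ≥ a` of (C1-law) is needed only off these strata.
-/

noncomputable section

namespace Summit.CriticalPhenomena.PercolationContinuityZ3.Theorems.SunflowerPartition

namespace PrincipalCore

open MeasureTheory Finset
open Literature.Probability.LatticeModels

variable {ι : Type*} {κ : Type*}

/-! ## The dual stratum: principal BOTTOM (reflection `ω ↦ ωᶜ`, `p ↦ 1 − p`) -/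

section Dual

variable [Finite ι]

/-- **Down-set form.**  For down-sets `D i` of a finite cube whose pairwise intersections are contained in the principal IDEAL
`{ω | ω ∩ g = ∅}`: `∏_i μ(D i) ≤ (∏_{e∈g} (1 − p e))^{|κ|−1}` (reflect and apply `prod_real_le_prod_pow` at `1 − p`). [this work] -/
theorem prod_real_le_prod_pow_of_isLowerSet [Fintype κ] (p : ι → unitInterval) {D : κ → Set (Set ι)}
    (hD : ∀ i, IsLowerSet (D i)) (g : Finset ι) (hcap : ∀ i j, i ≠ j → D i ∩ D j ⊆ {ω | ∀ e ∈ g, e ∉ ω}) :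
    ∏ i, (prodBernoulli p).real (D i) ≤ (∏ e ∈ g, (1 - (p e : ℝ))) ^ (Fintype.card κ - 1) := by
  classical
  let q : ι → unitInterval := fun i => unitInterval.symm (p i)
  have hV : ∀ i, IsUpperSet (compl ⁻¹' D i) := fun i => isUpperSet_preimage_compl (hD i)
  have hcap' : ∀ i j, i ≠ j → (compl ⁻¹' D i) ∩ (compl ⁻¹' D j) ⊆ {ω | (g : Set ι) ⊆ ω} := by
    intro i j hij ω hω e he
    have h := hcap i j hij hω e (Finset.mem_coe.1 he)
    simpa using h
  have key := prod_real_le_prod_pow q hV g hcap'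
  have hre : ∀ i, (prodBernoulli q).real (compl ⁻¹' D i) = (prodBernoulli p).real (D i) := fun i =>
    prodBernoulli_real_preimage_compl p MeasurableSet.of_discrete
  simp only [hre] at key
  have hq : ∀ e, ((q e : unitInterval) : ℝ) = 1 - (p e : ℝ) := fun e => unitInterval.coe_symm_eq (p e)
  simp only [hq] at key
  exact key

/-- **Lemma B shape for a principal bottom.**  ANY three up-sets `E_i` of a finite cube whose union has as complement the
principal ideal `{ω | ω ∩ g = ∅}` satisfy, with the down-sets `D_i = (E_j ∪ E_k)ᶜ`: `μ(D₁) μ(D₂) μ(D₃) ≤ μ((E₁ ∪ E₂ ∪ E₃)ᶜ)²`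
(no sunflower condition is needed: `D_i ∩ D_j = (E₁ ∪ E₂ ∪ E₃)ᶜ` always).  For a sunflower with core `A` this is Lemma B
`b(ab − e₂) ≥ e₃` (`e3_le_bottom_mul_AG`), since `D_i = B ⊔ (E_i ∖ A)`. [this work] -/
theorem lemmaB_of_principalBottom (p : ι → unitInterval) {E₁ E₂ E₃ : Set (Set ι)} (h₁ : IsUpperSet E₁) (h₂ : IsUpperSet E₂)
    (h₃ : IsUpperSet E₃) (g : Finset ι) (hB : (E₁ ∪ E₂ ∪ E₃)ᶜ = {ω | ∀ e ∈ g, e ∉ ω}) :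
    (prodBernoulli p).real (E₂ ∪ E₃)ᶜ * (prodBernoulli p).real (E₁ ∪ E₃)ᶜ * (prodBernoulli p).real (E₁ ∪ E₂)ᶜ ≤
      ((prodBernoulli p).real (E₁ ∪ E₂ ∪ E₃)ᶜ) ^ 2 := by
  let D : Fin 3 → Set (Set ι) := ![(E₂ ∪ E₃)ᶜ, (E₁ ∪ E₃)ᶜ, (E₁ ∪ E₂)ᶜ]
  have hD : ∀ i, IsLowerSet (D i) := by
    intro i; fin_cases i
    · exact (h₂.union h₃).compl
    · exact (h₁.union h₃).compl
    · exact (h₁.union h₂).compl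
  have hsub : ∀ i j, i ≠ j → D i ∩ D j ⊆ (E₁ ∪ E₂ ∪ E₃)ᶜ := by
    intro i j hij ω hω
    simp only [Set.mem_compl_iff, Set.mem_union, not_or]
    fin_cases i <;> fin_cases j
    all_goals first
      | exact (hij rfl).elim
      | (change ω ∈ (E₂ ∪ E₃)ᶜ ∩ (E₁ ∪ E₃)ᶜ at hω
         simp only [Set.mem_inter_iff, Set.mem_compl_iff, Set.mem_union, not_or] at hω; tauto)
      | (change ω ∈ (E₂ ∪ E₃)ᶜ ∩ (E₁ ∪ E₂)ᶜ at hω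
         simp only [Set.mem_inter_iff, Set.mem_compl_iff, Set.mem_union, not_or] at hω; tauto)
      | (change ω ∈ (E₁ ∪ E₃)ᶜ ∩ (E₂ ∪ E₃)ᶜ at hω
         simp only [Set.mem_inter_iff, Set.mem_compl_iff, Set.mem_union, not_or] at hω; tauto)
      | (change ω ∈ (E₁ ∪ E₃)ᶜ ∩ (E₁ ∪ E₂)ᶜ at hω
         simp only [Set.mem_inter_iff, Set.mem_compl_iff, Set.mem_union, not_or] at hω; tauto)
      | (change ω ∈ (E₁ ∪ E₂)ᶜ ∩ (E₂ ∪ E₃)ᶜ at hω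
         simp only [Set.mem_inter_iff, Set.mem_compl_iff, Set.mem_union, not_or] at hω; tauto)
      | (change ω ∈ (E₁ ∪ E₂)ᶜ ∩ (E₁ ∪ E₃)ᶜ at hω
         simp only [Set.mem_inter_iff, Set.mem_compl_iff, Set.mem_union, not_or] at hω; tauto)
  have hcap : ∀ i j, i ≠ j → D i ∩ D j ⊆ {ω | ∀ e ∈ g, e ∉ ω} := fun i j hij => (hsub i j hij).trans hB.le
  have key := prod_real_le_prod_pow_of_isLowerSet p hD g hcap
  rw [Fin.prod_univ_three] at key
  simp only [D, Matrix.cons_val_zero, Matrix.cons_val_one, Matrix.cons_val, Fintype.card_fin] at key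
  have hb : (prodBernoulli p).real (E₁ ∪ E₂ ∪ E₃)ᶜ = ∏ e ∈ g, (1 - (p e : ℝ)) := by
    rw [hB, prodBernoulli_real_forall_notMem]
  rw [hb]
  calc (prodBernoulli p).real (E₂ ∪ E₃)ᶜ * (prodBernoulli p).real (E₁ ∪ E₃)ᶜ * (prodBernoulli p).real (E₁ ∪ E₂)ᶜ
      ≤ (∏ e ∈ g, (1 - (p e : ℝ))) ^ (3 - 1) := key
    _ = (∏ e ∈ g, (1 - (p e : ℝ))) ^ 2 := by norm_num

/-- Cell bookkeeping, continued: for a three-petal sunflower `μ((E_j ∪ E_k)ᶜ) = b + c_i` (`(E_j ∪ E_k)ᶜ = B ⊔ (E_i ∖ A)`). [this work] -/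
theorem cells_eq' (p : ι → unitInterval) {E₁ E₂ E₃ A : Set (Set ι)}
    (h12 : E₁ ∩ E₂ = A) (h13 : E₁ ∩ E₃ = A) (h23 : E₂ ∩ E₃ = A) :
    (prodBernoulli p).real (E₂ ∪ E₃)ᶜ = (prodBernoulli p).real (E₁ ∪ E₂ ∪ E₃)ᶜ + (prodBernoulli p).real (E₁ \ A) ∧
    (prodBernoulli p).real (E₁ ∪ E₃)ᶜ = (prodBernoulli p).real (E₁ ∪ E₂ ∪ E₃)ᶜ + (prodBernoulli p).real (E₂ \ A) ∧
    (prodBernoulli p).real (E₁ ∪ E₂)ᶜ = (prodBernoulli p).real (E₁ ∪ E₂ ∪ E₃)ᶜ + (prodBernoulli p).real (E₃ \ A) := by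
  classical
  have m₁ : MeasurableSet E₁ := MeasurableSet.of_discrete
  have m₂ : MeasurableSet E₂ := MeasurableSet.of_discrete
  have m₃ : MeasurableSet E₃ := MeasurableSet.of_discrete
  obtain ⟨e₁, e₂, e₃, eB⟩ := cells_eq p h12 h13 h23
  have hU12 := measureReal_union_add_inter (μ := prodBernoulli p) (s := E₁) m₂
  have hU13 := measureReal_union_add_inter (μ := prodBernoulli p) (s := E₁) m₃
  have hU23 := measureReal_union_add_inter (μ := prodBernoulli p) (s := E₂) m₃
  rw [h12] at hU12
  rw [h13] at hU13
  rw [h23] at hU23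
  have c12 : (prodBernoulli p).real (E₁ ∪ E₂)ᶜ = 1 - (prodBernoulli p).real (E₁ ∪ E₂) := probReal_compl_eq_one_sub (m₁.union m₂)
  have c13 : (prodBernoulli p).real (E₁ ∪ E₃)ᶜ = 1 - (prodBernoulli p).real (E₁ ∪ E₃) := probReal_compl_eq_one_sub (m₁.union m₃)
  have c23 : (prodBernoulli p).real (E₂ ∪ E₃)ᶜ = 1 - (prodBernoulli p).real (E₂ ∪ E₃) := probReal_compl_eq_one_sub (m₂.union m₃)
  refine ⟨?_, ?_, ?_⟩ <;> linarith

/-- **Lemma B in cells** for a principal-BOTTOM sunflower of a finite cube: `c₁c₂c₃ ≤ b·(ab − e₂)`, unconditionally. [this work] -/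
theorem e3_le_bottom_mul_AG (p : ι → unitInterval) {E₁ E₂ E₃ A : Set (Set ι)} (h₁ : IsUpperSet E₁) (h₂ : IsUpperSet E₂)
    (h₃ : IsUpperSet E₃) (h12 : E₁ ∩ E₂ = A) (h13 : E₁ ∩ E₃ = A) (h23 : E₂ ∩ E₃ = A) (g : Finset ι)
    (hB : (E₁ ∪ E₂ ∪ E₃)ᶜ = {ω | ∀ e ∈ g, e ∉ ω}) :
    (prodBernoulli p).real (E₁ \ A) * (prodBernoulli p).real (E₂ \ A) * (prodBernoulli p).real (E₃ \ A) ≤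
      (prodBernoulli p).real (E₁ ∪ E₂ ∪ E₃)ᶜ * ((prodBernoulli p).real A * (prodBernoulli p).real (E₁ ∪ E₂ ∪ E₃)ᶜ -
        ((prodBernoulli p).real (E₁ \ A) * (prodBernoulli p).real (E₂ \ A) +
          (prodBernoulli p).real (E₁ \ A) * (prodBernoulli p).real (E₃ \ A) +
          (prodBernoulli p).real (E₂ \ A) * (prodBernoulli p).real (E₃ \ A))) := by
  have key := lemmaB_of_principalBottom p h₁ h₂ h₃ g hB
  obtain ⟨d₁, d₂, d₃⟩ := cells_eq' p h12 h13 h23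
  obtain ⟨-, -, -, eB⟩ := cells_eq p h12 h13 h23
  rw [d₁, d₂, d₃] at key
  -- `b² − Π(b + c_i) = b(ab − e₂) − e₃` because `a = 1 − b − Σ c_i`
  have ha : (prodBernoulli p).real A = 1 - (prodBernoulli p).real (E₁ ∪ E₂ ∪ E₃)ᶜ - (prodBernoulli p).real (E₁ \ A)
      - (prodBernoulli p).real (E₂ \ A) - (prodBernoulli p).real (E₃ \ A) := by linarith
  rw [ha]
  nlinarith [key]

/-- **(C1-law) on the principal-bottom stratum**: `e₃ ≤ max(a,b)·(ab − e₂)`, unconditionally. [this work] -/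
theorem e3_le_max_mul_AG_of_principalBottom (p : ι → unitInterval) {E₁ E₂ E₃ A : Set (Set ι)} (h₁ : IsUpperSet E₁)
    (h₂ : IsUpperSet E₂) (h₃ : IsUpperSet E₃) (h12 : E₁ ∩ E₂ = A) (h13 : E₁ ∩ E₃ = A) (h23 : E₂ ∩ E₃ = A) (g : Finset ι)
    (hB : (E₁ ∪ E₂ ∪ E₃)ᶜ = {ω | ∀ e ∈ g, e ∉ ω}) :
    (prodBernoulli p).real (E₁ \ A) * (prodBernoulli p).real (E₂ \ A) * (prodBernoulli p).real (E₃ \ A) ≤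
      max ((prodBernoulli p).real A) ((prodBernoulli p).real (E₁ ∪ E₂ ∪ E₃)ᶜ) *
        ((prodBernoulli p).real A * (prodBernoulli p).real (E₁ ∪ E₂ ∪ E₃)ᶜ -
          ((prodBernoulli p).real (E₁ \ A) * (prodBernoulli p).real (E₂ \ A) +
            (prodBernoulli p).real (E₁ \ A) * (prodBernoulli p).real (E₃ \ A) +
            (prodBernoulli p).real (E₂ \ A) * (prodBernoulli p).real (E₃ \ A))) := by
  have hLB := e3_le_bottom_mul_AG p h₁ h₂ h₃ h12 h13 h23 g hB
  have hAG := prodBernoulli_strongHarris_sunflower_three p h₁ h₂ h₃ h12 h13 h23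
  have hmax : (prodBernoulli p).real (E₁ ∪ E₂ ∪ E₃)ᶜ ≤
      max ((prodBernoulli p).real A) ((prodBernoulli p).real (E₁ ∪ E₂ ∪ E₃)ᶜ) := le_max_right _ _
  nlinarith [hmax, hAG, hLB]

end Dual

end PrincipalCore

end Summit.CriticalPhenomena.PercolationContinuityZ3.Theorems.SunflowerPartition
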